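import Summits.ABC.ABC.Theses.DefiniteXi
import Summits.ABC.ABC.Theses.RibetTakahashiSplit
import Literature.NumberTheory.EllipticCurves.PastenHeightBoundsLemma68LocalProofs
import Literature.NumberTheory.EllipticCurves.OpenImageMazurAssemblyProofs
import Literature.NumberTheory.EllipticCurves.OpenImageMazurCharacterProofs
import Literature.NumberTheory.EllipticCurves.OpenImageMazurTwistProofs
import Literature.NumberTheory.EllipticCurves.OpenImageMazurGoodAtNProofs
import Literature.NumberTheory.EllipticCurves.CyclicIsogenyCharacterFrobeniusProofs
import Literature.NumberTheory.EllipticCurves.SemistableModPImageMultiplicativeProofs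
import Literature.NumberTheory.EllipticCurves.RationalIsogenyDegreesProofs
import Literature.NumberTheory.EllipticCurves.WeilPairingCyclicComponentsDeterminantProofs
import HarnessLib

/-!
# Stub ideas k1 (gen 3) — `stub_pastenLemma68 : PastenShimura2024_lemma_6_8`
(crux `DefiniteRTControlPrime`, stmt-ABC-11338, route `DefiniteXi`; skeleton `Lines/Sketch.lean:79`)
— helper lemmas, elaborated.  FAMILY 1 (recognise & import).

* §A RECOGNISE: the stub IS the route item `DefiniteXi.IsogenyValuationTransport` (stmt-ABC-18928,
  `Iff.rfl`, landed `isogenyValuationTransport_iff`); closers-in-waiting from the radius item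
  (stmt-ABC-15193) and from the Mazur–Kenku fact — PROVED one-liners (A0–A3).
* §B Lemma 6.8 with a FREE constant `B` (PROVED, B1/B2): the form every Mazur-free re-cut consumes
  (`163 ↦ B`); `B = 163` from the radius is A2.
* §C the HALF-PRECISION single-line lemma (analogy transfer of Serre 1972 §5.4 / Mazur 1978 §5 from
  level `p` to level `p^e`, precision `p^⌈e/2⌉`, NO middle curve / split pair): C1, C2′, C9 PROVED;
  C2, C3, C4, C5, C6, C7, C8, C0 are `sorry`-stubs (sizes in the STUB-IDEAS file).
-/

noncomputable section

open scoped Classical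
open WeierstrassCurve IsDedekindDomain NumberField Field
open Literature.NumberTheory.EllipticCurves Literature.NumberTheory.EllipticCurves.ModularForms
open Literature.NumberTheory.GaloisRepresentations

namespace Summit.ABC.ABC.Cruxes.DefiniteRTControlPrime.StubIdeas1G3

/-! ## §A  RECOGNISE — the stub is a route item, verbatim -/

/-- **A0.** `stub_pastenLemma68`'s type IS the route item `IsogenyValuationTransport` (stmt-ABC-18928,
DefiniteXi r9 `aside`): definitional (`isogenyValuationTransport_iff := Iff.rfl` is landed in
`Theorems/DefiniteXiXiStrongBoundItemsCalibration.lean`). -/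
theorem A0_stub_iff_item :
    PastenShimura2024_lemma_6_8 ↔ Summit.ABC.ABC.Theses.DefiniteXi.IsogenyValuationTransport :=
  Iff.rfl

/-- **A0′.** Hence the stub closes by `exact` from the item. -/
theorem A0'_stub_of_item (h : Summit.ABC.ABC.Theses.DefiniteXi.IsogenyValuationTransport) :
    PastenShimura2024_lemma_6_8 :=
  h

/-- **A1.** … or from the Mazur–Kenku named fact (tree one-liner). -/
theorem A1_stub_of_mazurKenku (hMK : mazurKenku_exists_cyclic_isogeny) :
    PastenShimura2024_lemma_6_8 :=
  PastenShimura2024_lemma_6_8_of_mazurKenku' hMK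

/-! ## §B  Lemma 6.8 with a free constant (the form every re-cut consumes) -/

/-- **B1 (PROVED).** Pointwise Lemma 6.8 with `163 ↦ B` from ANY `ℚ`-isogeny of degree `≤ B`:
cyclic companion (`Isogeny.exists_isCyclic_degree_dvd`) + cyclic transport `c_v(W)·b = c_v(W')·a`,
`ab ∣ deg` (`exists_ordMinimalDiscriminant_mul_eq_mul_of_isCyclic`). Mazur-free.
[cite: PastenShimura2024, Lemma 6.8 p. 22] -/
theorem B1_lemma68Le_of_degree_le (B : ℕ) {W W' : WeierstrassCurve ℚ} [W.IsElliptic]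
    [W'.IsElliptic] (φ : Isogeny W W') (hB : φ.degree ≤ B) (v : HeightOneSpectrum ℤ)
    (hv : W.HasMultiplicativeReductionAt v) :
    ∃ m n : ℕ, 0 < m ∧ m ≤ B ∧ 0 < n ∧ n ≤ B ∧
      W.ordMinimalDiscriminant v * n = W'.ordMinimalDiscriminant v * m := by
  have hv' : W'.HasMultiplicativeReductionAt v :=
    hasMultiplicativeReductionAt_of_isIsogenous ⟨φ⟩ v hv
  obtain ⟨ψ, hcyc, hdvd⟩ := φ.exists_isCyclic_degree_dvd
  obtain ⟨a, b, ha, hb, hab, h⟩ :=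
    exists_ordMinimalDiscriminant_mul_eq_mul_of_isCyclic ψ.degree ψ hcyc rfl v hv hv'
  have habn : a * b ≤ B := (Nat.le_of_dvd φ.degree_pos (hab.trans hdvd)).trans hB
  refine ⟨a, b, ha, ?_, hb, ?_, h⟩
  · have : a ≤ a * b := Nat.le_mul_of_pos_right a hb
    omega
  · have : b ≤ a * b := Nat.le_mul_of_pos_left b ha
    omega

/-- Lemma 6.8 with a free constant `B`, as a statement family (`B = 163` is the stub's shape restricted
to pairs at `ℚ`-isogeny distance `≤ B`). -/
def LemmaSixEightLe (B : ℕ) : Prop :=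
  ∀ (W W' : WeierstrassCurve ℚ) [W.IsElliptic] [W'.IsElliptic],
    (∃ φ : Isogeny W W', φ.degree ≤ B) →
    ∀ v : HeightOneSpectrum ℤ, W.HasMultiplicativeReductionAt v →
      ∃ m n : ℕ, 0 < m ∧ m ≤ B ∧ 0 < n ∧ n ≤ B ∧
        W.ordMinimalDiscriminant v * n = W'.ordMinimalDiscriminant v * m

/-- **B2 (PROVED).** The whole family holds unconditionally. -/
theorem B2_lemmaSixEightLe (B : ℕ) : LemmaSixEightLe B := by
  intro W W' _ _ hφ v hv
  obtain ⟨φ, hB⟩ := hφ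
  exact B1_lemma68Le_of_degree_le B φ hB v hv

/-- **A2 (PROVED; the 1-cycle landing task `--supports stmt-ABC-18928`).** The item / stub from the
route's own radius item `DefiniteXi.MazurKenkuRadius` (stmt-ABC-15193). -/
theorem A2_item_of_radius (hR : Summit.ABC.ABC.Theses.DefiniteXi.MazurKenkuRadius) :
    Summit.ABC.ABC.Theses.DefiniteXi.IsogenyValuationTransport := by
  intro W W' _ _ hiso v hv
  obtain ⟨φ, hφ⟩ := hR W W' hiso
  exact B1_lemma68Le_of_degree_le 163 φ hφ v hv

/-- **A3 (PROVED).** Same from the `RibetTakahashiSplit` copy of the radius decl (the ledger dedups the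
three copies to stmt-ABC-15193). -/
theorem A3_stub_of_radius (hR : Summit.ABC.ABC.Theses.RibetTakahashiSplit.MazurKenkuRadius) :
    PastenShimura2024_lemma_6_8 :=
  A2_item_of_radius hR

/-! ## §C  The half-precision single-line lemma (Mazur-free polylog re-cut; this ideator's delta)

A `Γ_ℚ`-stable cyclic `K = ℤP`, `|K| = p^e`, `p` odd, on a curve semistable away from `2`, character
`c : Γ_ℚ → (ℤ/p^e)ˣ`.  Working MODULO `p^f`, `f = ⌈e/2⌉ = (e+1)/2`:
multiplicative `v ∤ p`: `(τ-1)²P = 0` (tree) ⇒ `c ≡ 1 (p^f)` (C1, C5); at `p`: a cyclic `Λ`, `|Λ| = p^e`,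
inertia `= θ` on `Λ` and `= 1` on `E[p^e]/Λ` (C4, via the triangular determinant C3) ⇒
`c|I_p ≡ θ^i (p^f)`, `i ∈ {0,1}` (C2, C2′ — `p^j = |K ⊓ Λ|`); at `2`: `c¹² ≡ 1 (p^f)` (C6).
Minkowski (`monoidHom_eq_one_of_forall_inertia`, k1-163 H5d) and one good Frobenius (k1-163 H5e /
k3-163 C4 at modulus `p^f`) give `p^f ∣ n₁₂(ℓ) = ℓ¹² + 1 − s₁₂(a_ℓ, ℓ)` (C7); counting (C9): odd part of
a cyclic degree `∣ (n₁₂(ℓ₀) n₁₂(ℓ₁))²` (C0). No middle curve (k1-163 H6 / k3-163 C1), no exactness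
device (H5a / C2a′); answers k2's `11a3 → 11a2` objection (`c ≡ 1 mod 5` on `I₁₁` suffices). -/

/-- **C1 (PROVED).** `p^e ∣ x² ⇒ p^⌈e/2⌉ ∣ x`. -/
theorem C1_pow_half_dvd_of_pow_dvd_sq {p : ℕ} (hp : p.Prime) (e : ℕ) {x : ℤ}
    (h : (p : ℤ) ^ e ∣ x ^ 2) : (p : ℤ) ^ ((e + 1) / 2) ∣ x := by
  rcases eq_or_ne x 0 with rfl | hx
  · exact dvd_zero _
  haveI := Fact.mk hp
  rw [padicValInt_dvd_iff] at h ⊢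
  rcases h with h | h
  · exact absurd h (pow_ne_zero 2 hx)
  · right
    rw [pow_two, padicValInt.mul hx hx] at h
    omega

/-- **C2** (S; subgroups of a cyclic `p`-group). A map `f` acting by the scalar `t` on a subgroup `Λ`,
by the scalar `c` on `K = ℤP` (`|K| = p^e`), with `f - 1 : K → Λ`: if `p^j = |K ⊓ Λ|` then
`p^j ∣ c - t` and `p^(e-j) ∣ c - 1`. -/
theorem C2_exponent_split {M : Type*} [AddCommGroup M] {p : ℕ} (hp : p.Prime) (e : ℕ)
    (f : M → M) (Λ : AddSubgroup M) (P : M) (hP : addOrderOf P = p ^ e) (t c : ℤ)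
    (hΛ : ∀ x ∈ Λ, f x = t • x) (hK : ∀ x ∈ AddSubgroup.zmultiples P, f x = c • x)
    (hq : ∀ x ∈ AddSubgroup.zmultiples P, f x - x ∈ Λ) :
    ∃ j ≤ e, (p : ℤ) ^ j ∣ c - t ∧ (p : ℤ) ^ (e - j) ∣ c - 1 := by
  sorry

/-- **C2′ (PROVED).** One of `j`, `e - j` is `≥ ⌈e/2⌉`. -/
theorem C2'_halfPow_dvd (p e j : ℕ) (hj : j ≤ e) {c t : ℤ}
    (h1 : (p : ℤ) ^ j ∣ c - t) (h2 : (p : ℤ) ^ (e - j) ∣ c - 1) :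
    (p : ℤ) ^ ((e + 1) / 2) ∣ c - 1 ∨ (p : ℤ) ^ ((e + 1) / 2) ∣ c - t := by
  rcases Nat.lt_or_ge j ((e + 1) / 2) with h | h
  · exact Or.inl ((pow_dvd_pow _ (by omega)).trans h2)
  · exact Or.inr ((pow_dvd_pow _ h).trans h1)

/-- **C3** (S; triangular determinant — the Weil-pairing computation of the landed
`intCast_mul_eq_modNCyclotomicCharacter_of_smul_eq_zsmul` with `σ g₂ = g₂ + y g₁` instead of
`σ g₂ = a₂ g₂`, using alternation `e_m(g₁,g₁) = 1`): `a₁ · 1 = χ_m(σ)`.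
[cite: SilvermanAEC2009, Prop. III.8.1] -/
theorem C3_intCast_eq_cyclotomic_of_triangular (W : WeierstrassCurve ℚ) [W.IsElliptic] (m : ℕ)
    [NeZero m] (hm : 2 ≤ m) {g₁ g₂ : geomTorsion W (m : ℤ)}
    (hspan : ∀ T : geomTorsion W (m : ℤ), ∃ c₁ c₂ : ℤ, T = c₁ • g₁ + c₂ • g₂)
    (ho₂ : addOrderOf g₂ = m) (σ : absoluteGaloisGroup ℚ) {a₁ y : ℤ} (ha₁ : σ • g₁ = a₁ • g₁)
    (ha₂ : σ • g₂ = g₂ + y • g₁) :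
    ((a₁ : ℤ) : ZMod m) = ((modNCyclotomicCharacter ℚ m σ : (ZMod m)ˣ) : ZMod m) := by
  sorry

/-- **C4** (M–L, HARDEST, shared with k1-163 H5b/H5c and k3-163 C2b — ONE port serves all three lines).
At `v ∣ p`, `p` odd, `W` semistable at `v`, given a stable line in `E[p]` (excludes supersingular,
k1-163 H5b₀): a cyclic `Λ = ℤX`, `|Λ| = p^e`, with inertia `= θ_{p^e}` on `Λ` (Tate `μ`-line, resp.
height-one formal group + C3) and `= 1` on `E[p^e]/Λ`.
[cite: SilvermanATAEC1994, V.3–V.5, Ex. 5.13] [cite: SilvermanAEC2009, VII.2–VII.3] -/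
theorem C4_exists_line_at_p (W : WeierstrassCurve ℚ) [W.IsElliptic] [W.IsGloballyMinimal]
    {p : ℕ} [Fact p.Prime] (hp2 : p ≠ 2) (e : ℕ) (he : 0 < e) [NeZero (p ^ e)]
    {v : HeightOneSpectrum (𝓞 ℚ)} (hpv : (p : 𝓞 ℚ) ∈ v.asIdeal)
    (hss : W.HasGoodReductionAt v ∨ W.HasMultiplicativeReductionAt v)
    (hline : ∃ P : geomPoints W, addOrderOf P = p ∧
      ∀ σ : absoluteGaloisGroup ℚ, σ • P ∈ AddSubgroup.zmultiples P)
    {𝔓 : Ideal (absIntegers (𝓞 ℚ) ℚ)} (h𝔓 : 𝔓 ∈ v.primesAbove) :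
    ∃ X : geomPoints W, addOrderOf X = p ^ e ∧
      (∀ τ ∈ 𝔓.inertia (absoluteGaloisGroup ℚ),
        τ • X = ((modNCyclotomicCharacter ℚ (p ^ e) τ : (ZMod (p ^ e))ˣ) : ZMod (p ^ e)).val • X) ∧
      ∀ τ ∈ 𝔓.inertia (absoluteGaloisGroup ℚ), ∀ R : geomPoints W,
        ((p ^ e : ℕ) : ℤ) • R = 0 → τ • R - R ∈ AddSubgroup.zmultiples X := by
  sorry

/-- **C5 (PROVED).** (multiplicative `v ∤ p`: unipotence `τ(τP - P) = τP - P` of the landed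
`smul_smul_sub_eq_of_mem_inertia_geomPoints` gives `(c-1)² P = 0`, i.e. `p^e ∣ (c-1)²`, then C1).
This congruence — not exact triviality — is all the global step needs (answers the `11a3 → 11a2`
objection: there `c|I₁₁` has order `5` but `c ≡ 1 mod 5`). -/
theorem C5_char_congr_one_of_multiplicative (W : WeierstrassCurve ℚ) [W.IsElliptic] {p : ℕ}
    [Fact p.Prime] (e : ℕ) (he : 0 < e) {v : HeightOneSpectrum (𝓞 ℚ)}
    (hpv : (p : 𝓞 ℚ) ∉ v.asIdeal) (hmult : W.HasMultiplicativeReductionAt v)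
    {𝔓 : Ideal (absIntegers (𝓞 ℚ) ℚ)} (h𝔓 : 𝔓 ∈ v.primesAbove)
    {P : geomPoints W} (hP : addOrderOf P = p ^ e) {τ : absoluteGaloisGroup ℚ}
    (hτ : τ ∈ 𝔓.inertia (absoluteGaloisGroup ℚ)) {c : ℤ} (hc : τ • P = c • P) :
    (p : ℤ) ^ ((e + 1) / 2) ∣ c - 1 := by
  have hp : p.Prime := Fact.out
  have hPe : p ^ e • P = 0 := by rw [← hP]; exact addOrderOf_nsmul_eq_zero P
  have hu := smul_smul_sub_eq_of_mem_inertia_geomPoints W hmult hp hpv he h𝔓 hτ hPe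
  rw [smul_sub, hc, smul_comm τ c P, hc] at hu
  -- `hu : c • c • P - c • P = c • P - P`, i.e. `(c-1)² P = 0`
  have h2 : ((c - 1) ^ 2) • P = 0 := by
    have h' : c • c • P - c • P - (c • P - P) = 0 := sub_eq_zero.mpr hu
    calc ((c - 1) ^ 2) • P = c • c • P - c • P - (c • P - P) := by module
      _ = 0 := h'
  have h3 : (p : ℤ) ^ e ∣ (c - 1) ^ 2 := by
    have := addOrderOf_dvd_iff_zsmul_eq_zero.mpr h2
    rwa [hP, Nat.cast_pow] at this
  exact C1_pow_half_dvd_of_pow_dvd_sq hp e h3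

/-- **C6** (S–M; the place `2`, `p` odd). Potentially good: inertia acts on `E[p^e]` through
`Φ ≤ Aut(Ẽ) ≤ SL₂(𝔽₃)`, whose abelian quotients have exponent `∣ 12`, so `c¹² = 1`; potentially
multiplicative: `(τ ∓ 1)² = 0` on `E[p^e]` (twisted Tate), so `c ≡ ±1`, `c² ≡ 1 (mod p^⌈e/2⌉)` by C1.
Level-`p^e` version of the landed `isogenyCharacter_pow_twelve_eq_one` /
`isogenyCharacter_sq_eq_one_of_one_lt_valuation_j` (= k1-163 H5c± weakened to a congruence).
[cite: SerreInventiones1972, §5.6] [cite: Mazur1978, §5] -/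
theorem C6_char_pow_twelve_at_two (W : WeierstrassCurve ℚ) [W.IsElliptic] [W.IsGloballyMinimal]
    {p : ℕ} [Fact p.Prime] (hp2 : p ≠ 2) (e : ℕ) (he : 0 < e) {v : HeightOneSpectrum (𝓞 ℚ)}
    (h2v : (2 : 𝓞 ℚ) ∈ v.asIdeal) {𝔓 : Ideal (absIntegers (𝓞 ℚ) ℚ)} (h𝔓 : 𝔓 ∈ v.primesAbove)
    {P : geomPoints W} (hP : addOrderOf P = p ^ e)
    (hst : ∀ σ : absoluteGaloisGroup ℚ, σ • P ∈ AddSubgroup.zmultiples P)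
    {τ : absoluteGaloisGroup ℚ} (hτ : τ ∈ 𝔓.inertia (absoluteGaloisGroup ℚ)) {c : ℤ}
    (hc : τ • P = c • P) :
    (p : ℤ) ^ ((e + 1) / 2) ∣ c ^ 12 - 1 := by
  sorry

/-- **C7** (M; ASSEMBLY of C1–C6 + k1-163 H5b₀/H5u/H5d/H5e (modulus `p^⌈e/2⌉`) + the landed eigenvalue
relation `Mazur1978.exists_root_charpoly_mod_of_cyclicCharacter`): a stable cyclic `ℤP` of order
`p^e` on a curve semistable away from `2` forces `p^⌈e/2⌉ ∣ n₁₂(ℓ)` at every odd good `ℓ ≠ p`.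
Single line, no split pair (compare k1-163 `primePow_dvd_frobNorm_of_split`). -/
theorem C7_halfPow_dvd_frobNorm_of_stableLine (W₁ : WeierstrassCurve ℚ) [W₁.IsElliptic]
    [W₁.IsGloballyMinimal] (p e : ℕ) [Fact p.Prime] (hp2 : p ≠ 2) (he : 0 < e)
    (hss : ∀ v : HeightOneSpectrum (𝓞 ℚ), (2 : 𝓞 ℚ) ∉ v.asIdeal → W₁.IsSemistableAt v)
    {P : geomPoints W₁} (hP : addOrderOf P = p ^ e)
    (hst : ∀ σ : absoluteGaloisGroup ℚ, σ • P ∈ AddSubgroup.zmultiples P)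
    (ℓ : ℕ) [Fact ℓ.Prime] (hℓ2 : ℓ ≠ 2) (hℓp : ℓ ≠ p) (hgood : W₁.HasGoodReductionAtPrime ℓ) :
    (p : ℤ) ^ ((e + 1) / 2) ∣
      (ℓ : ℤ) ^ 12 + 1 - Mazur1978.frobTracePow (W₁.frobeniusTrace ℓ) ℓ 12 := by
  sorry

/-- **C8** (S; the stable line from a cyclic isogeny: the `p^e`-part of a cyclic kernel is a
`Γ_ℚ`-stable cyclic subgroup — `Isogeny.exists_isCyclic_degree_eq_of_dvd` + the kernel is
`Γ_ℚ`-stable). -/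
theorem C8_exists_stablePoint_of_isCyclic {W₁ W₂ : WeierstrassCurve ℚ} [W₁.IsElliptic]
    [W₂.IsElliptic] (φ : Isogeny W₁ W₂) (hφ : φ.IsCyclic) (p e : ℕ) [Fact p.Prime]
    (hdiv : p ^ e ∣ φ.degree) :
    ∃ P : geomPoints W₁, addOrderOf P = p ^ e ∧
      ∀ σ : absoluteGaloisGroup ℚ, σ • P ∈ AddSubgroup.zmultiples P := by
  sorry

/-- **C9 (PROVED).** Half-exponents at every odd prime ⇒ an odd `d` divides `n²`
(k3-163 C5 needs `n³` because it only has `⌊e/2⌋` + the radical). -/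
theorem C9_dvd_sq_of_halfPow_dvd {d n : ℕ} (hd : 0 < d) (hn : 0 < n)
    (h : ∀ p : ℕ, p.Prime → p ∣ d → p ^ ((d.factorization p + 1) / 2) ∣ n) : d ∣ n ^ 2 := by
  rw [← Nat.factorization_le_iff_dvd hd.ne' (pow_pos hn 2).ne', Nat.factorization_pow]
  intro p
  by_cases hp : p.Prime
  · by_cases hpd : p ∣ d
    · have h2 : (d.factorization p + 1) / 2 ≤ n.factorization p := by
        rw [← hp.pow_dvd_iff_le_factorization hn.ne']
        exact h p hp hpd
      simp only [Finsupp.smul_apply, smul_eq_mul]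
      omega
    · simp [Nat.factorization_eq_zero_of_not_dvd hpd]
  · simp [Nat.factorization_eq_zero_of_not_prime d hp]

/-- **C0** (M bookkeeping; the reshaped Mazur-free target with exponent `2`): for `V` globally minimal
and semistable away from `2`, `ψ` cyclic, `ℓ₀ ≠ ℓ₁` odd good primes, the odd part of `deg ψ` divides
`(n₁₂(ℓ₀) n₁₂(ℓ₁))²` (C7 for each odd `p^e ∥ deg ψ`, `p = ℓ₀` served by `ℓ₁`; C8; C9).  With
`n₁₂(ℓ) ≤ (ℓ⁶+1)²` (k1-163 `frobNorm_pos_and_le`), two odd good primes `≪ log N`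
(k1-163 `exists_two_odd_primes_not_dvd`) and the 2-part `≤ 16` (landed level `32`) this is k1-163's
`FreyIsogenyDiameter`, whence the crux via `definiteRTControlPrime_of_diameter` — whose `hval` is B1. -/
theorem C0_oddPart_degree_dvd_sq (V V' : WeierstrassCurve ℚ) [V.IsElliptic] [V'.IsElliptic]
    [V.IsGloballyMinimal] (ψ : Isogeny V V') (hψ : ψ.IsCyclic)
    (hss : ∀ v : HeightOneSpectrum (𝓞 ℚ), (2 : 𝓞 ℚ) ∉ v.asIdeal → V.IsSemistableAt v)
    (ℓ₀ ℓ₁ : ℕ) [Fact ℓ₀.Prime] [Fact ℓ₁.Prime] (h02 : ℓ₀ ≠ 2) (h12 : ℓ₁ ≠ 2) (h01 : ℓ₀ ≠ ℓ₁)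
    (hg0 : V.HasGoodReductionAtPrime ℓ₀) (hg1 : V.HasGoodReductionAtPrime ℓ₁) :
    ψ.degree / 2 ^ (ψ.degree.factorization 2) ∣
      (((ℓ₀ : ℤ) ^ 12 + 1 - Mazur1978.frobTracePow (V.frobeniusTrace ℓ₀) ℓ₀ 12).natAbs *
        ((ℓ₁ : ℤ) ^ 12 + 1 - Mazur1978.frobTracePow (V.frobeniusTrace ℓ₁) ℓ₁ 12).natAbs) ^ 2 := by
  sorry

/-! ## Sanity (in-Lean, `decide`): the half-precision prediction on the two `ℚ`-classes with a cyclic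
odd prime-square isogeny at a curve semistable away from `2` -/

/-- `11a3 → 11a2` cyclic `25` (`p^e = 5²`, `f = 1`), `ℓ = 3`, `a₃(11a) = -1`: `5 ∣ n₁₂(3)`
(in fact `5² ‖ n₁₂(3) = 532800`). -/
example : (5 : ℤ) ^ ((2 + 1) / 2) ∣ (3 : ℤ) ^ 12 + 1 - Mazur1978.frobTracePow (-1) 3 12 := by decide

/-- `14a` cyclic `9` (`p^e = 3²`, `f = 1`; `3` good ordinary for `14a`, `a₃ = -2`), `ℓ = 5`,
`a₅(14a) = 0`: `3 ∣ n₁₂(5)`. -/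
example : (3 : ℤ) ^ ((2 + 1) / 2) ∣ (5 : ℤ) ^ 12 + 1 - Mazur1978.frobTracePow 0 5 12 := by decide

end Summit.ABC.ABC.Cruxes.DefiniteRTControlPrime.StubIdeas1G3

end
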